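import Summits.Schanuel.Schanuel.Theorems.SoloInformedTheoremAE1

/-!
# Theorem AE-1τ: the eventual inequalities

Soloist file (informed mode, seat `solo-Schanuel-informed`, s180).  Asymptotic bookkeeping for
the seat's THEOREM AE-1τ (`paper/AE-note.md` §9, `η = 0` form; node [cite: Roy2010, Thm 1.1]):
with `K = ⌊n^σ⌋`, `t = ⌊n^τ/2⌋ + 1` (`0 < σ, τ`, `σ + τ < 1`, `β ≥ 1`) the explicit hypotheses
of `soloAT_gelfond_input` hold for all large `n` — `soloTT_tfloor` (`2 ≤ t`, `2(t-1) ≤ n^τ`,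
`n^τ/2 ≤ t ≤ n^τ`), `soloTT_Kt` (`K t ≤ n`), `soloTT_condA'` (the margin of Lemma T′),
`soloTT_condB'` (the count of bad points, `1 + β < σ + τ + ν`), `soloTT_condD'` (the budget of
THEOREM C — THIS is where `ν > β + 4(1 - σ - τ)` is used), `soloTT_condE'` (the dilation
losses), and the comparison with Gel'fond's sequences `soloTT_condF'`, `soloTT_condG'`
(degree `O(n^{1-σ-τ})`, type `O(n^{1-σ-τ} log n + n^{β-σ-τ})`); `soloTT_cmp` transfers the
`W`-inequalities of THEOREM AE-1 (`soloT1_condB/C/H`, stated for `n^{ν'} K/(200 n)`) to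
`W = n^ν K / (800 n)` via `4 n^{ν'} ≤ n^ν`.

What this is NOT.  Pure real-analysis bookkeeping; nothing here bears on
`Literature.Periods.SchanuelConjecture` (the seat's verdict, no path, is unchanged).  Tree
files and Mathlib only; no definitions; axioms the standard three.
-/

namespace Summit.Schanuel.Schanuel.Theorems

open Filter

/-- Eventually `t = ⌊n^τ/2⌋ + 1` satisfies `2 ≤ t`, `2(t-1) ≤ n^τ` and `n^τ/2 ≤ t ≤ n^τ`. -/
theorem soloTT_tfloor {τ : ℝ} (hτ0 : 0 < τ) :
    ∀ᶠ n : ℕ in atTop, 2 ≤ ⌊(n : ℝ) ^ τ / 2⌋₊ + 1 ∧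
      2 * (((⌊(n : ℝ) ^ τ / 2⌋₊ + 1 : ℕ) : ℝ) - 1) ≤ (n : ℝ) ^ τ ∧
      (n : ℝ) ^ τ / 2 ≤ ((⌊(n : ℝ) ^ τ / 2⌋₊ + 1 : ℕ) : ℝ) ∧
      ((⌊(n : ℝ) ^ τ / 2⌋₊ + 1 : ℕ) : ℝ) ≤ (n : ℝ) ^ τ := by
  filter_upwards [eventually_const_mul_rpow_le_rpow hτ0 2] with n h
  rw [Real.rpow_zero, mul_one] at h
  have hpos : 0 ≤ (n : ℝ) ^ τ / 2 := by positivity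
  have hfl : ((⌊(n : ℝ) ^ τ / 2⌋₊ : ℕ) : ℝ) ≤ (n : ℝ) ^ τ / 2 := Nat.floor_le hpos
  have hfl' : (n : ℝ) ^ τ / 2 < ((⌊(n : ℝ) ^ τ / 2⌋₊ : ℕ) : ℝ) + 1 := Nat.lt_floor_add_one _
  have h1 : 1 ≤ ⌊(n : ℝ) ^ τ / 2⌋₊ := Nat.le_floor (by rw [Nat.cast_one]; linarith)
  refine ⟨by omega, ?_, ?_, ?_⟩
  · push_cast; linarith
  · push_cast; linarith
  · push_cast; linarith

/-- Eventually `K t ≤ n` (`K = ⌊n^σ⌋`, `t = ⌊n^τ/2⌋ + 1`, `σ + τ < 1`). -/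
theorem soloTT_Kt {σ τ : ℝ} (hσ0 : 0 < σ) (hτ0 : 0 < τ) (hστ : σ + τ < 1) :
    ∀ᶠ n : ℕ in atTop, ⌊(n : ℝ) ^ σ⌋₊ * (⌊(n : ℝ) ^ τ / 2⌋₊ + 1) ≤ n := by
  filter_upwards [soloT1_floor hσ0, soloTT_tfloor hτ0]
    with n ⟨hn1, _u1, hKle, _u2⟩ ⟨_u3, _u4, _u5, ht⟩
  have hn0 : (0 : ℝ) < n := by linarith
  have h : ((⌊(n : ℝ) ^ σ⌋₊ * (⌊(n : ℝ) ^ τ / 2⌋₊ + 1) : ℕ) : ℝ) ≤ n := by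
    rw [Nat.cast_mul]
    calc (⌊(n : ℝ) ^ σ⌋₊ : ℝ) * ((⌊(n : ℝ) ^ τ / 2⌋₊ + 1 : ℕ) : ℝ)
        ≤ (n : ℝ) ^ σ * (n : ℝ) ^ τ := mul_le_mul hKle ht (by positivity) (by positivity)
      _ = (n : ℝ) ^ (σ + τ) := by rw [Real.rpow_add hn0]
      _ ≤ (n : ℝ) ^ (1 : ℝ) := Real.rpow_le_rpow_of_exponent_le hn1 hστ.le
      _ = n := Real.rpow_one _
  exact_mod_cast h

/-- `n/t ≤ 2 n^{1-τ}`, `2n^β/t ≤ 4 n^{β-τ}`, `20 (n/t)/K ≤ 80 n^{1-σ-τ}` and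
`20 (2n^β/t)/K ≤ 160 n^{β-σ-τ}` when `t ≥ n^τ/2 > 0` and `K ≥ n^σ/2 > 0`. -/
theorem soloTT_over_tK {β σ τ : ℝ} {n : ℕ} (hn : (1 : ℝ) ≤ n) {t K : ℝ} (ht0 : 0 < t)
    (ht : (n : ℝ) ^ τ / 2 ≤ t) (hK0 : 0 < K) (hK : (n : ℝ) ^ σ / 2 ≤ K) :
    (n : ℝ) / t ≤ 2 * (n : ℝ) ^ (1 - τ) ∧ 2 * (n : ℝ) ^ β / t ≤ 4 * (n : ℝ) ^ (β - τ) ∧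
      20 * ((n : ℝ) / t) / K ≤ 80 * (n : ℝ) ^ (1 - σ - τ) ∧
      20 * (2 * (n : ℝ) ^ β / t) / K ≤ 160 * (n : ℝ) ^ (β - σ - τ) := by
  have hn0 : (0 : ℝ) < n := by linarith
  have hτpos : 0 < (n : ℝ) ^ τ := by positivity
  have hσpos : 0 < (n : ℝ) ^ σ := by positivity
  have e1 : (n : ℝ) ^ (1 - τ) = n / (n : ℝ) ^ τ := by rw [Real.rpow_sub hn0, Real.rpow_one]
  have e2 : (n : ℝ) ^ (β - τ) = (n : ℝ) ^ β / (n : ℝ) ^ τ := by rw [Real.rpow_sub hn0]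
  have e3 : (n : ℝ) ^ (1 - σ - τ) = (n : ℝ) ^ (1 - τ) / (n : ℝ) ^ σ := by
    rw [show 1 - σ - τ = (1 - τ) - σ by ring, Real.rpow_sub hn0]
  have e4 : (n : ℝ) ^ (β - σ - τ) = (n : ℝ) ^ (β - τ) / (n : ℝ) ^ σ := by
    rw [show β - σ - τ = (β - τ) - σ by ring, Real.rpow_sub hn0]
  have hA : (n : ℝ) / t ≤ 2 * (n : ℝ) ^ (1 - τ) := by
    rw [e1, div_le_iff₀ ht0]
    calc (n : ℝ) = 2 * (n / (n : ℝ) ^ τ) * ((n : ℝ) ^ τ / 2) := by field_simp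
      _ ≤ 2 * (n / (n : ℝ) ^ τ) * t := mul_le_mul_of_nonneg_left ht (by positivity)
  have hB : 2 * (n : ℝ) ^ β / t ≤ 4 * (n : ℝ) ^ (β - τ) := by
    rw [e2, div_le_iff₀ ht0]
    calc 2 * (n : ℝ) ^ β = 4 * ((n : ℝ) ^ β / (n : ℝ) ^ τ) * ((n : ℝ) ^ τ / 2) := by
          field_simp
          ring
      _ ≤ 4 * ((n : ℝ) ^ β / (n : ℝ) ^ τ) * t := mul_le_mul_of_nonneg_left ht (by positivity)
  have hpos1 : 0 ≤ (n : ℝ) ^ (1 - τ) := by positivity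
  have hpos2 : 0 ≤ (n : ℝ) ^ (β - τ) := by positivity
  refine ⟨hA, hB, ?_, ?_⟩
  · rw [div_le_iff₀ hK0, e3]
    calc 20 * ((n : ℝ) / t) ≤ 20 * (2 * (n : ℝ) ^ (1 - τ)) := by linarith
      _ = 80 * ((n : ℝ) ^ (1 - τ) / (n : ℝ) ^ σ) * ((n : ℝ) ^ σ / 2) := by
          field_simp
          ring
      _ ≤ 80 * ((n : ℝ) ^ (1 - τ) / (n : ℝ) ^ σ) * K :=
          mul_le_mul_of_nonneg_left hK (by positivity)
  · rw [div_le_iff₀ hK0, e4]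
    calc 20 * (2 * (n : ℝ) ^ β / t) ≤ 20 * (4 * (n : ℝ) ^ (β - τ)) := by linarith
      _ = 160 * ((n : ℝ) ^ (β - τ) / (n : ℝ) ^ σ) * ((n : ℝ) ^ σ / 2) := by
          field_simp
          ring
      _ ≤ 160 * ((n : ℝ) ^ (β - τ) / (n : ℝ) ^ σ) * K :=
          mul_le_mul_of_nonneg_left hK (by positivity)

/-- `W/2 = n^ν K / (1600 n) ≥ n^{ν+σ-1}/3200` and `W ≥ n^{ν+σ-1}/1600` (`W = (n^ν/2) K/(400 n)`)
when `K ≥ n^σ/2`. -/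
theorem soloTT_W_lower {σ ν : ℝ} {n : ℕ} (hn : (1 : ℝ) ≤ n) {K : ℝ}
    (hK : (n : ℝ) ^ σ / 2 ≤ K) :
    (n : ℝ) ^ (ν + σ - 1) / 1600 ≤ (n : ℝ) ^ ν / 2 * K / (400 * n) ∧
      (n : ℝ) ^ (ν + σ - 1) / 3200 ≤ (n : ℝ) ^ ν / 2 * K / (400 * n) / 2 := by
  have h := soloT1_W_lower (ν := ν) hn hK
  have e : (n : ℝ) ^ ν / 2 * K / (400 * n) = (n : ℝ) ^ ν * K / (400 * n) / 2 := by ring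
  rw [e]
  constructor <;> linarith

/-- Transfer of the `W`-inequalities of THEOREM AE-1 (stated for `n^{ν'} K/(200 n)` and its
half) to `W = (n^ν/2) K / (400 n)` and `W/2`, given `4 n^{ν'} ≤ n^ν`. -/
theorem soloTT_cmp {ν ν' : ℝ} {n : ℕ} (hn : (0 : ℝ) < n) {K : ℝ} (hK : 0 ≤ K)
    (h : 4 * (n : ℝ) ^ ν' ≤ (n : ℝ) ^ ν) :
    (n : ℝ) ^ ν' * K / (200 * n) ≤ (n : ℝ) ^ ν / 2 * K / (400 * n) ∧
      (n : ℝ) ^ ν' * K / (400 * n) ≤ (n : ℝ) ^ ν / 2 * K / (800 * n) ∧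
      (n : ℝ) ^ ν' * K / (400 * n) ≤ (n : ℝ) ^ ν / 2 * K / (400 * n) / 2 := by
  have hKn := mul_le_mul_of_nonneg_right h hK
  refine ⟨?_, ?_, ?_⟩
  · calc (n : ℝ) ^ ν' * K / (200 * n) = 4 * (n : ℝ) ^ ν' * K / (800 * n) := by ring
      _ ≤ (n : ℝ) ^ ν * K / (800 * n) := div_le_div_of_nonneg_right hKn (by positivity)
      _ = (n : ℝ) ^ ν / 2 * K / (400 * n) := by ring
  · calc (n : ℝ) ^ ν' * K / (400 * n) = 4 * (n : ℝ) ^ ν' * K / (1600 * n) := by ring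
      _ ≤ (n : ℝ) ^ ν * K / (1600 * n) := div_le_div_of_nonneg_right hKn (by positivity)
      _ = (n : ℝ) ^ ν / 2 * K / (800 * n) := by ring
  · calc (n : ℝ) ^ ν' * K / (400 * n) = 4 * (n : ℝ) ^ ν' * K / (1600 * n) := by ring
      _ ≤ (n : ℝ) ^ ν * K / (1600 * n) := div_le_div_of_nonneg_right hKn (by positivity)
      _ = (n : ℝ) ^ ν / 2 * K / (400 * n) / 2 := by ring

/-- Hypothesis `hA` of `soloAT_gelfond_input` (the margin of Lemma T′), eventually:
`n^τ + 4 n log(2 + K‖ξ‖) - n log(min 1 ‖ξ‖) ≤ 3 n^ν / 8` when `τ < ν`, `1 < ν`. -/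
theorem soloTT_condA' {ξ : ℂ} (hξ0 : ξ ≠ 0) {σ τ ν : ℝ} (hσ0 : 0 < σ) (hσ1 : σ < 1)
    (hτν : τ < ν) (hν : 1 < ν) :
    ∀ᶠ n : ℕ in atTop, (n : ℝ) ^ ν / 8 ≤ ((n : ℝ) ^ ν - (n : ℝ) ^ τ) - (n : ℝ) ^ ν / 2 -
      4 * n * Real.log (2 + ⌊(n : ℝ) ^ σ⌋₊ * ‖ξ‖) + n * Real.log (min 1 ‖ξ‖) := by
  have hm0 : 0 < min 1 ‖ξ‖ := lt_min one_pos (norm_pos_iff.mpr hξ0)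
  have hL0 : 0 ≤ Real.log (2 + ‖ξ‖) := Real.log_nonneg (by linarith [norm_nonneg ξ])
  have hκ0 : 0 < (ν - 1) / 2 := by linarith
  have hlt1 : 1 + (ν - 1) / 2 < ν := by linarith
  filter_upwards [soloT1_floor hσ0, eventually_const_mul_rpow_le_rpow hτν 16,
    eventually_const_mul_rpow_le_rpow hν (16 * (4 * Real.log (2 + ‖ξ‖) -
      Real.log (min 1 ‖ξ‖))),
    eventually_const_mul_rpow_le_rpow hlt1 (16 * (4 / ((ν - 1) / 2)))]
    with n ⟨hn1, _u6, hKle, _u7⟩ ha hb hc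
  rw [Real.rpow_one] at hb
  have hn0 : (0 : ℝ) < n := by linarith
  have hKn : (⌊(n : ℝ) ^ σ⌋₊ : ℝ) ≤ n := hKle.trans (by
    calc (n : ℝ) ^ σ ≤ (n : ℝ) ^ (1 : ℝ) := Real.rpow_le_rpow_of_exponent_le hn1 hσ1.le
      _ = n := Real.rpow_one _)
  have hK0 : (0 : ℝ) ≤ ⌊(n : ℝ) ^ σ⌋₊ := Nat.cast_nonneg _
  have hlog : Real.log (2 + ⌊(n : ℝ) ^ σ⌋₊ * ‖ξ‖) ≤ Real.log (2 + ‖ξ‖) + Real.log n := by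
    have h1 : 2 + ⌊(n : ℝ) ^ σ⌋₊ * ‖ξ‖ ≤ (2 + ‖ξ‖) * n := by nlinarith [norm_nonneg ξ]
    calc Real.log (2 + ⌊(n : ℝ) ^ σ⌋₊ * ‖ξ‖) ≤ Real.log ((2 + ‖ξ‖) * n) :=
          Real.log_le_log (by positivity) h1
      _ = Real.log (2 + ‖ξ‖) + Real.log n := by
          rw [Real.log_mul (by positivity) hn0.ne']
  have hlogn : Real.log n ≤ (n : ℝ) ^ ((ν - 1) / 2) / ((ν - 1) / 2) :=
    Real.log_le_rpow_div hn0.le hκ0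
  have e : (n : ℝ) * (n : ℝ) ^ ((ν - 1) / 2) = (n : ℝ) ^ (1 + (ν - 1) / 2) := by
    rw [Real.rpow_add hn0, Real.rpow_one]
  have h4 : 4 * n * Real.log (2 + ⌊(n : ℝ) ^ σ⌋₊ * ‖ξ‖) ≤
      4 * Real.log (2 + ‖ξ‖) * n + 4 / ((ν - 1) / 2) * (n : ℝ) ^ (1 + (ν - 1) / 2) := by
    calc 4 * n * Real.log (2 + ⌊(n : ℝ) ^ σ⌋₊ * ‖ξ‖)
        ≤ 4 * n * (Real.log (2 + ‖ξ‖) + (n : ℝ) ^ ((ν - 1) / 2) / ((ν - 1) / 2)) := by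
          apply mul_le_mul_of_nonneg_left _ (by positivity)
          linarith
      _ = 4 * Real.log (2 + ‖ξ‖) * n +
          4 / ((ν - 1) / 2) * ((n : ℝ) * (n : ℝ) ^ ((ν - 1) / 2)) := by ring
      _ = _ := by rw [e]
  have hν0 : 0 ≤ (n : ℝ) ^ ν := by positivity
  linarith [ha, hb, hc, h4]

/-- Hypothesis `hbud` of `soloAT_gelfond_input` (the count of bad points), eventually, when
`1 + β < σ + τ + ν`. -/
theorem soloTT_condB' {β σ τ ν : ℝ} (hβ : 1 ≤ β) (hσ0 : 0 < σ) (hτ0 : 0 < τ)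
    (h : 1 + β < σ + τ + ν) :
    ∀ᶠ n : ℕ in atTop, 200 * (10 * (n : ℝ) ^ 2 + 2 * n * (n + (n : ℝ) ^ β)) ≤
      ⌊(n : ℝ) ^ σ⌋₊ * (((⌊(n : ℝ) ^ τ / 2⌋₊ + 1 : ℕ) : ℝ) * ((n : ℝ) ^ ν / 8)) := by
  filter_upwards [soloT1_floor hσ0, soloTT_tfloor hτ0,
    eventually_const_mul_rpow_le_rpow h 89600]
    with n ⟨hn1, _u8, _u9, hKge⟩ ⟨_u10, _u11, htge, _u12⟩ hc
  have hn0 : (0 : ℝ) < n := by linarith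
  have h2 : (n : ℝ) ^ 2 ≤ (n : ℝ) ^ (1 + β) := by
    rw [show (n : ℝ) ^ 2 = (n : ℝ) ^ ((2 : ℕ) : ℝ) by rw [Real.rpow_natCast]]
    exact Real.rpow_le_rpow_of_exponent_le hn1 (by push_cast; linarith)
  have h3 : (n : ℝ) * (n : ℝ) ^ β = (n : ℝ) ^ (1 + β) := by
    rw [Real.rpow_add hn0, Real.rpow_one]
  have hL : 200 * (10 * (n : ℝ) ^ 2 + 2 * n * (n + (n : ℝ) ^ β)) ≤
      2800 * (n : ℝ) ^ (1 + β) := by nlinarith [h2, h3]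
  have hR : (n : ℝ) ^ (σ + τ + ν) / 32 ≤
      ⌊(n : ℝ) ^ σ⌋₊ * (((⌊(n : ℝ) ^ τ / 2⌋₊ + 1 : ℕ) : ℝ) * ((n : ℝ) ^ ν / 8)) := by
    rw [Real.rpow_add hn0, Real.rpow_add hn0]
    calc (n : ℝ) ^ σ * (n : ℝ) ^ τ * (n : ℝ) ^ ν / 32
        = ((n : ℝ) ^ σ / 2) * (((n : ℝ) ^ τ / 2) * ((n : ℝ) ^ ν / 8)) := by ring
      _ ≤ _ := by gcongr
  linarith [hc]

/-- Powers of `n ≥ 1`: `(n^a)^k = n^{a k}` and monotonicity in the exponent. -/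
theorem soloTT_rpow_pow {n : ℕ} (hn : (0 : ℝ) ≤ n) (a : ℝ) (k : ℕ) :
    ((n : ℝ) ^ a) ^ k = (n : ℝ) ^ (a * k) := by
  rw [← Real.rpow_natCast, ← Real.rpow_mul hn]

/-- Hypothesis `h₅` of `soloAT_gelfond_input` (the budget of THEOREM C), eventually — the one
place where `ν > β + 4(1 - σ - τ)` is used. -/
theorem soloTT_condD' {β σ τ ν : ℝ} (hβ : 1 ≤ β) (hσ0 : 0 < σ) (hτ0 : 0 < τ)
    (hν : β + 4 * (1 - σ - τ) < ν) :
    ∀ᶠ n : ℕ in atTop,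
      11000 * (2 * ((n : ℝ) / ((⌊(n : ℝ) ^ τ / 2⌋₊ + 1 : ℕ) : ℝ)) ^ 3 *
          (2 * (n : ℝ) ^ β / ((⌊(n : ℝ) ^ τ / 2⌋₊ + 1 : ℕ) : ℝ)) +
        2 * ((n : ℝ) / ((⌊(n : ℝ) ^ τ / 2⌋₊ + 1 : ℕ) : ℝ)) ^ 4) ≤
      (⌊(n : ℝ) ^ σ⌋₊ : ℝ) ^ 3 * ((n : ℝ) ^ ν / 2 * ⌊(n : ℝ) ^ σ⌋₊ / (800 * n)) := by
  have hlt : 3 + β - 4 * τ < 4 * σ + ν - 1 := by linarith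
  filter_upwards [soloT1_floor hσ0, soloTT_tfloor hτ0,
    eventually_const_mul_rpow_le_rpow hlt (11000 * 96 * 25600)]
    with n ⟨hn1, hK1, _u13, hKge⟩ ⟨_u14, _u15, htge, _u16⟩ hc
  have hn0 : (0 : ℝ) < n := by linarith
  set t : ℝ := ((⌊(n : ℝ) ^ τ / 2⌋₊ + 1 : ℕ) : ℝ) with htdef
  set K : ℝ := (⌊(n : ℝ) ^ σ⌋₊ : ℝ) with hKdef
  have ht0 : 0 < t := by rw [htdef]; positivity
  have hK0 : 0 < K := by
    rw [hKdef]
    exact_mod_cast (show 0 < ⌊(n : ℝ) ^ σ⌋₊ by omega)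
  obtain ⟨hx, hy, -, -⟩ := soloTT_over_tK (β := β) (σ := σ) hn1 ht0 htge hK0 hKge
  have hx0 : 0 ≤ (n : ℝ) / t := by positivity
  -- the left side is at most `11000 · 96 · n^{3+β-4τ}`
  have e1 : ((n : ℝ) ^ (1 - τ)) ^ 3 * (n : ℝ) ^ (β - τ) = (n : ℝ) ^ (3 + β - 4 * τ) := by
    rw [soloTT_rpow_pow hn0.le, ← Real.rpow_add hn0]
    congr 1
    push_cast
    ring
  have e2 : ((n : ℝ) ^ (1 - τ)) ^ 4 ≤ (n : ℝ) ^ (3 + β - 4 * τ) := by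
    rw [soloTT_rpow_pow hn0.le]
    exact Real.rpow_le_rpow_of_exponent_le hn1 (by push_cast; linarith)
  have hx3 : ((n : ℝ) / t) ^ 3 ≤ (2 * (n : ℝ) ^ (1 - τ)) ^ 3 := pow_le_pow_left₀ hx0 hx 3
  have hx4 : ((n : ℝ) / t) ^ 4 ≤ (2 * (n : ℝ) ^ (1 - τ)) ^ 4 := pow_le_pow_left₀ hx0 hx 4
  have hL : 11000 * (2 * ((n : ℝ) / t) ^ 3 * (2 * (n : ℝ) ^ β / t) + 2 * ((n : ℝ) / t) ^ 4) ≤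
      11000 * 96 * (n : ℝ) ^ (3 + β - 4 * τ) := by
    have h1 : ((n : ℝ) / t) ^ 3 * (2 * (n : ℝ) ^ β / t) ≤
        (2 * (n : ℝ) ^ (1 - τ)) ^ 3 * (4 * (n : ℝ) ^ (β - τ)) :=
      mul_le_mul hx3 hy (by positivity) (by positivity)
    have h1' : (2 * (n : ℝ) ^ (1 - τ)) ^ 3 * (4 * (n : ℝ) ^ (β - τ)) =
        32 * (n : ℝ) ^ (3 + β - 4 * τ) := by rw [← e1]; ring
    have h2' : (2 * (n : ℝ) ^ (1 - τ)) ^ 4 = 16 * ((n : ℝ) ^ (1 - τ)) ^ 4 := by ring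
    nlinarith [h1, h1', h2', hx4, e2]
  -- the right side is at least `n^{4σ+ν-1} / 25600`
  have hR : (n : ℝ) ^ (4 * σ + ν - 1) / 25600 ≤ K ^ 3 * ((n : ℝ) ^ ν / 2 * K / (800 * n)) := by
    have hK4 : ((n : ℝ) ^ σ / 2) ^ 4 ≤ K ^ 4 := pow_le_pow_left₀ (by positivity) hKge 4
    have e3 : (n : ℝ) ^ (4 * σ + ν - 1) = ((n : ℝ) ^ σ) ^ 4 * (n : ℝ) ^ ν / n := by
      rw [soloTT_rpow_pow hn0.le, Real.rpow_sub hn0, Real.rpow_add hn0, Real.rpow_one]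
      congr 2
      push_cast
      ring_nf
    rw [e3]
    have hν0 : 0 ≤ (n : ℝ) ^ ν := by positivity
    calc ((n : ℝ) ^ σ) ^ 4 * (n : ℝ) ^ ν / n / 25600
        = ((n : ℝ) ^ σ / 2) ^ 4 * (n : ℝ) ^ ν / (1600 * n) := by
          field_simp
          ring
      _ ≤ K ^ 4 * (n : ℝ) ^ ν / (1600 * n) :=
          div_le_div_of_nonneg_right (mul_le_mul_of_nonneg_right hK4 hν0) (by positivity)
      _ = K ^ 3 * ((n : ℝ) ^ ν / 2 * K / (800 * n)) := by ring
  linarith [hc]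

/-- Hypothesis `h₆` of `soloAT_gelfond_input` (the dilation losses), eventually, when
`1 - τ < ν + σ - 1` and `β - σ - τ < ν + σ - 1`. -/
theorem soloTT_condE' (ξ : ℂ) {β σ τ ν : ℝ} (hσ0 : 0 < σ) (hτ0 : 0 < τ)
    (hm1 : 1 - τ < ν + σ - 1) (hm2 : β - σ - τ < ν + σ - 1) :
    ∀ᶠ n : ℕ in atTop,
      20 * ((n : ℝ) / ((⌊(n : ℝ) ^ τ / 2⌋₊ + 1 : ℕ) : ℝ)) / ⌊(n : ℝ) ^ σ⌋₊ *
          Real.log (⌊(n : ℝ) ^ σ⌋₊ * ‖ξ‖ + 1) +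
        20 * (2 * (n : ℝ) ^ β / ((⌊(n : ℝ) ^ τ / 2⌋₊ + 1 : ℕ) : ℝ)) / ⌊(n : ℝ) ^ σ⌋₊ ≤
      (n : ℝ) ^ ν / 2 * ⌊(n : ℝ) ^ σ⌋₊ / (400 * n) / 2 := by
  filter_upwards [soloT1_floor hσ0, soloTT_tfloor hτ0,
    eventually_const_mul_rpow_le_rpow hm1 (6400 * (80 * ‖ξ‖)),
    eventually_const_mul_rpow_le_rpow hm2 (6400 * 160)]
    with n ⟨hn1, hK1, hKle, hKge⟩ ⟨_u17, _u18, htge, _u19⟩ ha hb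
  have hn0 : (0 : ℝ) < n := by linarith
  set t : ℝ := ((⌊(n : ℝ) ^ τ / 2⌋₊ + 1 : ℕ) : ℝ) with htdef
  set K : ℝ := (⌊(n : ℝ) ^ σ⌋₊ : ℝ) with hKdef
  have ht0 : 0 < t := by rw [htdef]; positivity
  have hK0 : 0 < K := by
    rw [hKdef]
    exact_mod_cast (show 0 < ⌊(n : ℝ) ^ σ⌋₊ by omega)
  obtain ⟨_u20, _u21, hx, hy⟩ := soloTT_over_tK (β := β) (σ := σ) hn1 ht0 htge hK0 hKge
  obtain ⟨_u22, hW⟩ := soloTT_W_lower (ν := ν) hn1 hKge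
  have hKξ : 0 ≤ K * ‖ξ‖ := mul_nonneg hK0.le (norm_nonneg ξ)
  have hlog0 : 0 ≤ Real.log (K * ‖ξ‖ + 1) := Real.log_nonneg (by linarith)
  have hlog : Real.log (K * ‖ξ‖ + 1) ≤ (n : ℝ) ^ σ * ‖ξ‖ := by
    have h1 : Real.log (K * ‖ξ‖ + 1) ≤ K * ‖ξ‖ := by
      have := Real.add_one_le_exp (K * ‖ξ‖)
      exact (Real.log_le_iff_le_exp (by positivity)).mpr this
    exact h1.trans (mul_le_mul_of_nonneg_right hKle (norm_nonneg ξ))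
  have e : (n : ℝ) ^ (1 - σ - τ) * (n : ℝ) ^ σ = (n : ℝ) ^ (1 - τ) := by
    rw [← Real.rpow_add hn0]
    ring_nf
  have h1 : 20 * ((n : ℝ) / t) / K * Real.log (K * ‖ξ‖ + 1) ≤
      80 * ‖ξ‖ * (n : ℝ) ^ (1 - τ) := by
    calc 20 * ((n : ℝ) / t) / K * Real.log (K * ‖ξ‖ + 1)
        ≤ 80 * (n : ℝ) ^ (1 - σ - τ) * ((n : ℝ) ^ σ * ‖ξ‖) :=
          mul_le_mul hx hlog hlog0 (by positivity)
      _ = 80 * ‖ξ‖ * ((n : ℝ) ^ (1 - σ - τ) * (n : ℝ) ^ σ) := by ring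
      _ = 80 * ‖ξ‖ * (n : ℝ) ^ (1 - τ) := by rw [e]
  linarith [ha, hb, h1, hy, hW]

/-- The degree bound against Gel'fond's sequence: `20 (n/t)/K < (n+1)^{e₁}` eventually when
`1 - σ - τ < e₁` (`σ + τ < 1`). -/
theorem soloTT_condF' {σ τ e₁ : ℝ} (hσ0 : 0 < σ) (hτ0 : 0 < τ) (hστ : σ + τ < 1)
    (he : 1 - σ - τ < e₁) :
    ∀ᶠ n : ℕ in atTop,
      20 * ((n : ℝ) / ((⌊(n : ℝ) ^ τ / 2⌋₊ + 1 : ℕ) : ℝ)) / ⌊(n : ℝ) ^ σ⌋₊ <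
        ((n : ℝ) + 1) ^ e₁ := by
  filter_upwards [soloT1_floor hσ0, soloTT_tfloor hτ0,
    eventually_const_mul_rpow_le_rpow he 81]
    with n ⟨hn1, hK1, _u23, hKge⟩ ⟨_u24, _u25, htge, _u26⟩ ha
  have hn0 : (0 : ℝ) < n := by linarith
  have ht0 : (0 : ℝ) < ((⌊(n : ℝ) ^ τ / 2⌋₊ + 1 : ℕ) : ℝ) := by positivity
  have hK0 : (0 : ℝ) < ⌊(n : ℝ) ^ σ⌋₊ := by
    exact_mod_cast (show 0 < ⌊(n : ℝ) ^ σ⌋₊ by omega)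
  obtain ⟨_u27, _u28, hx, _u29⟩ := soloTT_over_tK (β := 1) (σ := σ) hn1 ht0 htge hK0 hKge
  have hpos : 0 < (n : ℝ) ^ (1 - σ - τ) := by positivity
  have hmono : (n : ℝ) ^ e₁ ≤ ((n : ℝ) + 1) ^ e₁ :=
    Real.rpow_le_rpow hn0.le (by linarith) (by linarith)
  linarith

/-- The type bound against Gel'fond's sequence:
`20 (n/t)/K · (2 + log K) + 20 (2n^β/t)/K < (n+1)^{e₂}` eventually when
`1 - σ - τ + κ/2 < e₂`, `β - σ - τ < e₂` (`κ > 0`, `σ + τ < 1`). -/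
theorem soloTT_condG' {β σ τ κ e₂ : ℝ} (hσ0 : 0 < σ) (hσ1 : σ < 1) (hτ0 : 0 < τ)
    (hστ : σ + τ < 1) (hκ : 0 < κ) (he1 : 1 - σ - τ + κ / 2 < e₂) (he2 : β - σ - τ < e₂) :
    ∀ᶠ n : ℕ in atTop,
      20 * ((n : ℝ) / ((⌊(n : ℝ) ^ τ / 2⌋₊ + 1 : ℕ) : ℝ)) / ⌊(n : ℝ) ^ σ⌋₊ *
          (2 + Real.log ⌊(n : ℝ) ^ σ⌋₊) +
        20 * (2 * (n : ℝ) ^ β / ((⌊(n : ℝ) ^ τ / 2⌋₊ + 1 : ℕ) : ℝ)) / ⌊(n : ℝ) ^ σ⌋₊ <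
        ((n : ℝ) + 1) ^ e₂ := by
  have he0 : 1 - σ - τ < e₂ := by linarith
  have hκ2 : 0 < κ / 2 := by linarith
  filter_upwards [soloT1_floor hσ0, soloTT_tfloor hτ0,
    eventually_const_mul_rpow_le_rpow he0 (4 * 160),
    eventually_const_mul_rpow_le_rpow he1 (4 * (80 / (κ / 2))),
    eventually_const_mul_rpow_le_rpow he2 (4 * 160)]
    with n ⟨hn1, hK1, hKle, hKge⟩ ⟨_u30, _u31, htge, _u32⟩ ha hb hc
  have hn0 : (0 : ℝ) < n := by linarith
  have ht0 : (0 : ℝ) < ((⌊(n : ℝ) ^ τ / 2⌋₊ + 1 : ℕ) : ℝ) := by positivity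
  have hK0 : (0 : ℝ) < ⌊(n : ℝ) ^ σ⌋₊ := by
    exact_mod_cast (show 0 < ⌊(n : ℝ) ^ σ⌋₊ by omega)
  obtain ⟨_u33, _u34, hx, hy⟩ := soloTT_over_tK (β := β) (σ := σ) hn1 ht0 htge hK0 hKge
  have hKn : (⌊(n : ℝ) ^ σ⌋₊ : ℝ) ≤ n := hKle.trans (by
    calc (n : ℝ) ^ σ ≤ (n : ℝ) ^ (1 : ℝ) := Real.rpow_le_rpow_of_exponent_le hn1 hσ1.le
      _ = n := Real.rpow_one _)
  have hlogK : Real.log ⌊(n : ℝ) ^ σ⌋₊ ≤ (n : ℝ) ^ (κ / 2) / (κ / 2) :=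
    (Real.log_le_log hK0 hKn).trans (Real.log_le_rpow_div hn0.le hκ2)
  have hK1' : 1 ≤ ⌊(n : ℝ) ^ σ⌋₊ := le_trans (by norm_num) hK1
  have hlogK0 : 0 ≤ Real.log ⌊(n : ℝ) ^ σ⌋₊ := Real.log_nonneg (by exact_mod_cast hK1')
  have e : (n : ℝ) ^ (1 - σ - τ) * (n : ℝ) ^ (κ / 2) = (n : ℝ) ^ (1 - σ - τ + κ / 2) := by
    rw [← Real.rpow_add hn0]
  have hpos : 0 < (n : ℝ) ^ (1 - σ - τ) := by positivity
  have h1 : 20 * ((n : ℝ) / ((⌊(n : ℝ) ^ τ / 2⌋₊ + 1 : ℕ) : ℝ)) / ⌊(n : ℝ) ^ σ⌋₊ *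
      (2 + Real.log ⌊(n : ℝ) ^ σ⌋₊) ≤
      160 * (n : ℝ) ^ (1 - σ - τ) + 80 / (κ / 2) * (n : ℝ) ^ (1 - σ - τ + κ / 2) := by
    calc 20 * ((n : ℝ) / ((⌊(n : ℝ) ^ τ / 2⌋₊ + 1 : ℕ) : ℝ)) / ⌊(n : ℝ) ^ σ⌋₊ *
          (2 + Real.log ⌊(n : ℝ) ^ σ⌋₊)
        ≤ 80 * (n : ℝ) ^ (1 - σ - τ) * (2 + (n : ℝ) ^ (κ / 2) / (κ / 2)) :=
          mul_le_mul hx (by linarith) (by positivity) (by positivity)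
      _ = 160 * (n : ℝ) ^ (1 - σ - τ) +
          80 / (κ / 2) * ((n : ℝ) ^ (1 - σ - τ) * (n : ℝ) ^ (κ / 2)) := by ring
      _ = _ := by rw [e]
  have hmono : (n : ℝ) ^ e₂ ≤ ((n : ℝ) + 1) ^ e₂ :=
    Real.rpow_le_rpow hn0.le (by linarith) (by linarith)
  linarith [ha, hb, hc, h1, hy]

end Summit.Schanuel.Schanuel.Theorems
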